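import Mathlib
import HarnessLib
import Summits.HubbardSuperconductivity.HubbardSuperconductivity.Theorems.KLProgrammeC4aCooperDefectMixedPP
import Summits.HubbardSuperconductivity.HubbardSuperconductivity.Theorems.KLProgrammeC4aTransversalityGaussLaw
import Summits.HubbardSuperconductivity.HubbardSuperconductivity.Theorems.KLProgrammeC4aPartnerBandJetCounting
import Summits.HubbardSuperconductivity.HubbardSuperconductivity.Theorems.KLProgrammeC4aAbsBubbleAngleLayer

/-!
# Route `KLProgramme` — crux C4a, S3 brick (B4) «(U1)-HYBRID» part D-3c (i): THE η-SCALED ROWS OF THE pp PARTNER BAND NEAR THE COOPER CONFIGURATION —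
# slopes at the two crossings `≥ (G/2)·|ϑ − π|` on a FIXED neighbourhood, jet ceilings `H₀, H₁ ∝ |ϑ − π|`, second angular derivative `≲ ‖S‖`

Cell `gate-hubbard-kl`, seat hubbard-kl-k3c3-p3 (g37; row «implicit-function / monotonicity route for μ(n)»).  Located brick for the (C)-closer lane / the (M4)
assembly of the first-order ϑ-layer (stub (C) `stub_twoLeg_curvature` of `KLRegimeEngineV17F2`, stmt-HubbardSuperconductivity-20437), memo
HOME/hubbard-kl-k3c3-p3/U1-CAUSTIC-SUP.md §19 addendum (c) «D-3: the near-(C) ratio-form key lemma».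

WHY.  The direct COOPER part of the first-order layer is counted in the co-moving currency (`…C4aUmkDirectLevelLine`), which needs the KEY LEMMA
`|𝒜_φ| ≤ C₁|ē| + C₂|e| + C₃|ρ|` with `η`-FREE constants on the Cooper window `|ϑ − π| ≤ η₀` (`η := ϑ − π`).  At `e = ρ = 0` both the level-`0` profile
`f = ē(0,·;0,ϑ,θ)` and the anisotropy defect `h = 𝒜_φ(0,·) = ∂_ψ|_θ ē` vanish IDENTICALLY at `η = 0` (exact nesting, `…C4aPathRigidity`), so the control must be the
RATIO form `…C4aTransversalZeroControl.abs_le_mul_abs_of_transversal_zeros_deriv` with ALL FOUR data `σ, κ, H₀, H₁ ∝ |η|` and a FIXED `δ`: then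
`Q = max(H₁/σ, H₀/κ)` is `η`-free.  This file supplies the rows that scale (the floor `κ` is part (ii), the assembly part (iii)):
* §0 `torusDist_pi_add_eq`, `abs_sub_pi_le_min_torusDist` — near `π` both torus distances of the Gauss-map law dominate `|ϑ − π|`;
* §1 `deriv_partnerBand_pp_angle_eq` — the loop-angle slope IS the anisotropy expression of `…C4aCooperDefectMixedPP` with zero velocity, hence
  **`abs_deriv_deriv_partnerBand_pp_angle_le`**: `|∂²_φ ē| ≤ (K₃msD₁² + K₂msD₂)·‖S‖` (vanishes at exact nesting) and the Lipschitz form `abs_deriv_partnerBand_pp_angle_sub_le`;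
* §2 (at `ρ = 0`) **`exists_sign_slope_row_at_k_cooper`**, **`exists_sign_slope_row_at_q_cooper`** — with `G = (2/π)(Dt−2A)u_min·(u_min w/(4+2A))` the Gauss rate
  (`…C4aTransversalityGaussLaw`) and the row `(K₃msD₁² + K₂msD₂)msD₁·δ ≤ G/2`: `(G/2)|ϑ − π| ≤ εᵢ·∂_φ ē(0,x;0,ϑ,θ)` for `|x − zᵢ| ≤ δ`, `zᵢ ∈ {0, ϑ}`, `εᵢ = ±1`;
  **`abs_baseDeriv_partnerBand_pp_le_cooper_zero`** (`H₀`: `|𝒜_φ| ≤ (K₁msD₂ + K₂msD₁²)|ϑ − π|`, `…C4aPartnerBandCooperDefect`),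
  **`abs_deriv_baseDeriv_partnerBand_pp_le_cooper_zero`** (`H₁`: `|∂_φ𝒜_φ| ≤ (K₂msD₁msD₂ + (K₃msD₁² + K₂msD₂)msD₁)|ϑ − π|`, `…C4aCooperDefectMixedPP`).
Sizes binder shape + clause (i) `GeomConstants` of `FrameOK`; pure calculus on landed objects; nothing asserts (C), K3 or superconductivity.
References: FST II CPAM 51 (1998) §3 Thm 3.5 [cite: FeldmanSalmhoferTrubowitz1998]; BGM 2003 §7.1 Lemma 7.1 [cite: BenfattoGiulianiMastropietro2003];
BGM 2006 §2.4 (2.40) [cite: BenfattoGiulianiMastropietro2006].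
-/

noncomputable section

namespace Summit.HubbardSuperconductivity.HubbardSuperconductivity.Theorems.C4a

set_option linter.dupNamespace false -- summit = problem name (single-conjunct summit), D-0017

open Real Set Filter
open scoped Topology
open Literature.MathematicalPhysics.QuantumLattice Literature.MathematicalPhysics.QuantumLattice.BandSectorCounting Literature.Probability.LatticeModels
open Literature.MathematicalPhysics.QuantumLattice.FermiRG
open Summit.HubbardSuperconductivity.HubbardSuperconductivity.Theorems.KLRegimeSplit
open Summit.HubbardSuperconductivity.HubbardSuperconductivity.Theorems.DispersionFlow
open Summit.HubbardSuperconductivity.HubbardSuperconductivity.Theorems.PerturbedFermiCurve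

/-! ## §0 Torus bookkeeping near the Cooper angle -/

/-- `‖π + η‖_𝕋 = π − |η|` for `|η| ≤ π`. -/
theorem torusDist_pi_add_eq {η : ℝ} (hη : |η| ≤ π) : torusDist (π + η) = π - |η| := by
  rcases le_or_gt 0 η with h | h
  · rw [abs_of_nonneg h, show π + η = (η - π) + (1 : ℤ) * (2 * π) by push_cast; ring, torusDist_add_int_mul_two_pi,
      torusDist_eq_abs_of_abs_le_pi (by rw [abs_le]; constructor <;> linarith [(abs_le.1 hη).2]),
      abs_of_nonpos (by linarith [(abs_le.1 hη).2])]
    ring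
  · rw [abs_of_neg h, torusDist_eq_abs_of_abs_le_pi (by rw [abs_le]; constructor <;> linarith [(abs_le.1 hη).1, Real.pi_pos]),
      abs_of_nonneg (by linarith [(abs_le.1 hη).1, Real.pi_pos])]
    ring

/-- Near the Cooper angle both torus distances of the Gauss-map law dominate the distance to `π`: `|ϑ − π| ≤ min(‖ϑ‖_𝕋, ‖ϑ − π‖_𝕋)` for `|ϑ − π| ≤ π/2`. -/
theorem abs_sub_pi_le_min_torusDist {ϑ : ℝ} (hϑ : |ϑ - π| ≤ π / 2) : |ϑ - π| ≤ min (torusDist ϑ) (torusDist (ϑ - π)) := by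
  have h1 : torusDist (ϑ - π) = |ϑ - π| := torusDist_eq_abs_of_abs_le_pi (by linarith [Real.pi_pos])
  have h2 : torusDist ϑ = π - |ϑ - π| := by
    have := torusDist_pi_add_eq (η := ϑ - π) (by linarith [Real.pi_pos]); rwa [show π + (ϑ - π) = ϑ by ring] at this
  rw [h1, h2]; exact le_min (by linarith) le_rfl

/-- `d/dx f(x + θ) = f⁽¹⁾(x + θ)`. -/
theorem deriv_comp_add_const_eq_iteratedDeriv {E : Type*} [NormedAddCommGroup E] [NormedSpace ℝ E] (f : ℝ → E) (θ x : ℝ) :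
    deriv (fun y : ℝ => f (y + θ)) x = iteratedDeriv 1 f (x + θ) := by
  rw [iteratedDeriv_one]; exact deriv_comp_add_const f θ x

section Sizes

variable {K : TrigPolyC4v} {A : ℝ} (hA : ∀ p : Momentum, ∀ j ≤ 2, ‖iteratedFDeriv ℝ j (frameShift K) p‖ ≤ A) (hA20 : A ≤ 1 / 20)
  (hd : klCurveD ≤ (bandBounds (show (-4 : ℝ) < -1.1 by norm_num) (show (-1.1 : ℝ) ≤ -0.1 by norm_num)
    (show (-0.1 : ℝ) < 0 by norm_num)).Dtmin - 2 * A)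
  {μ r : ℝ} (hr : 0 < r) (hlo : (-1.1 : ℝ) < μ - r - A) (hhi : μ + r + A < -0.1)
  {A₃ A₄ : ℝ} (hA₃ : ∀ p : Momentum, ‖iteratedFDeriv ℝ 3 (frameShift K) p‖ ≤ A₃)
  (hA₄ : ∀ p : Momentum, ‖iteratedFDeriv ℝ 4 (frameShift K) p‖ ≤ A₄)
  {K₁ K₂ K₃ : ℝ} (hK₁ : ∀ p : Momentum, ‖fderiv ℝ (frameLevel μ K) p‖ ≤ K₁) (hK₂ : ∀ p : Momentum, ‖iteratedFDeriv ℝ 2 (frameLevel μ K) p‖ ≤ K₂)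
  (hK₃ : ∀ p : Momentum, ‖iteratedFDeriv ℝ 3 (frameLevel μ K) p‖ ≤ K₃)
include hA hA20 hd hr hlo hhi hA₃ hA₄ hK₁ hK₂ hK₃

/-! ## §1 The loop-angle slope as an anisotropy expression; the second angular derivative vanishes at exact nesting -/

omit hA20 hr hA₃ hA₄ hK₁ hK₂ hK₃ in
/-- **The loop-angle slope of the pp partner band is the anisotropy expression with zero velocity**:
`∂_φ e_K(S − Φ(e,φ+θ)) = De_K(S − Φ(e,φ+θ))[0 − ∂_φΦ(e,φ+θ)]` as functions of `φ`. -/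
theorem deriv_partnerBand_pp_angle_eq (ρ : ℝ) {e : ℝ} (he : |e| < r) (ϑ θ : ℝ) :
    deriv (fun x : ℝ => frameLevel μ K (pairSumPath μ K ρ ϑ θ 0 - levelPoint μ K e (x + θ))) =
      fun x : ℝ => (fderiv ℝ (frameLevel μ K) (pairSumPath μ K ρ ϑ θ 0 - levelPoint μ K e (x + θ)))
        (0 - deriv (fun y : ℝ => levelPoint μ K e (y + θ)) x) := by
  funext x
  rw [(hasDerivAt_partnerBand_pp_angle hA hd hlo hhi (ρ := ρ) he ϑ θ x).deriv, zero_sub, map_neg, deriv_comp_add_const_eq_iteratedDeriv]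

omit hr hK₁ in
/-- **The second loop-angle derivative of the pp partner band is `≲ ‖S‖`**: `|∂²_φ e_K(S − Φ(e,φ+θ))| ≤ (K₃msD₁² + K₂msD₂)·‖S‖` — it vanishes at exact
nesting (`S = 0`, `e_K(−Φ(e,·)) ≡ e`).  (`…C4aCooperDefectMixedPP` with zero velocity.) -/
theorem abs_deriv_deriv_partnerBand_pp_angle_le (ρ : ℝ) {e : ℝ} (he : |e| < r) (ϑ θ φ : ℝ) :
    |deriv (deriv (fun x : ℝ => frameLevel μ K (pairSumPath μ K ρ ϑ θ 0 - levelPoint μ K e (x + θ)))) φ| ≤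
      (K₃ * msD A₃ A₄ 1 ^ 2 + K₂ * msD A₃ A₄ 2) * ‖pairSumPath μ K ρ ϑ θ 0‖ := by
  rw [deriv_partnerBand_pp_angle_eq hA hd hlo hhi ρ he ϑ θ]
  have h := abs_deriv_anisotropy_pp_le_cooper hA hA20 hd hlo hhi hA₃ hA₄ hK₂ hK₃ he θ (pairSumPath μ K ρ ϑ θ 0) 0 φ
  rw [norm_zero, mul_zero, zero_add] at h
  exact h

omit hr hK₁ in
/-- **Lipschitz form**: `|∂_φ ē(x) − ∂_φ ē(y)| ≤ (K₃msD₁² + K₂msD₂)·‖S‖·|x − y|`. -/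
theorem abs_deriv_partnerBand_pp_angle_sub_le (ρ : ℝ) {e : ℝ} (he : |e| < r) (ϑ θ x y : ℝ) :
    |deriv (fun t : ℝ => frameLevel μ K (pairSumPath μ K ρ ϑ θ 0 - levelPoint μ K e (t + θ))) x -
        deriv (fun t : ℝ => frameLevel μ K (pairSumPath μ K ρ ϑ θ 0 - levelPoint μ K e (t + θ))) y| ≤
      (K₃ * msD A₃ A₄ 1 ^ 2 + K₂ * msD A₃ A₄ 2) * ‖pairSumPath μ K ρ ϑ θ 0‖ * |x - y| := by
  set f : ℝ → ℝ := fun t => frameLevel μ K (pairSumPath μ K ρ ϑ θ 0 - levelPoint μ K e (t + θ)) with hf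
  have hC : ContDiff ℝ 2 f := contDiff_partnerBand_pp_angle hA hd hlo hhi ρ he ϑ θ 2
  have h1 : ContDiff ℝ 1 (deriv f) := by have := hC.iterate_deriv' 1 1; simpa using this
  have hdiff : ∀ t ∈ (univ : Set ℝ), DifferentiableAt ℝ (deriv f) t := fun t _ => (h1.differentiable (by norm_num)) t
  have hbound : ∀ t ∈ (univ : Set ℝ), ‖deriv (deriv f) t‖ ≤ (K₃ * msD A₃ A₄ 1 ^ 2 + K₂ * msD A₃ A₄ 2) * ‖pairSumPath μ K ρ ϑ θ 0‖ := by
    intro t _; rw [Real.norm_eq_abs]; exact abs_deriv_deriv_partnerBand_pp_angle_le hA hA20 hd hlo hhi hA₃ hA₄ hK₂ hK₃ ρ he ϑ θ t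
  have h := (convex_univ (𝕜 := ℝ) (E := ℝ)).norm_image_sub_le_of_norm_deriv_le hdiff hbound (mem_univ y) (mem_univ x)
  rwa [Real.norm_eq_abs, Real.norm_eq_abs] at h

/-! ## §2 The rows at `ρ = 0` near the Cooper configuration -/

omit hK₁ in
/-- **SLOPE ROW AT THE CROSSING `k` (`φ = 0`), NEAR COOPER, `ρ = e = 0`**: under clause (i) of `FrameOK`, with the Gauss rate
`G = (2/π)(Dt−2A)u_min·(u_min·w/(4+2A))`, for `|ϑ − π| ≤ π/2` and a radius `δ` with `(K₃msD₁² + K₂msD₂)·msD₁·δ ≤ G/2` there is a sign `ε = ±1` with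
`(G/2)·|ϑ − π| ≤ ε·∂_φ ē(0,x;0,ϑ,θ)` for all `|x| ≤ δ`. [cite: BenfattoGiulianiMastropietro2003, §7.1 Lemma 7.1 (A1.9)] -/
theorem exists_sign_slope_row_at_k_cooper {Kc r₀ g₀ w : ℝ} (hG : GeomConstants (frameLevel μ K) Kc r₀ g₀ w) {ϑ : ℝ} (hϑ : |ϑ - π| ≤ π / 2) (θ : ℝ)
    {δ : ℝ}
    (hδrow : (K₃ * msD A₃ A₄ 1 ^ 2 + K₂ * msD A₃ A₄ 2) * msD A₃ A₄ 1 * δ ≤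
      (2 / π * (((bandBounds (show (-4 : ℝ) < -1.1 by norm_num) (show (-1.1 : ℝ) ≤ -0.1 by norm_num) (show (-0.1 : ℝ) < 0 by norm_num)).Dtmin - 2 * A) *
        (bandBounds (show (-4 : ℝ) < -1.1 by norm_num) (show (-1.1 : ℝ) ≤ -0.1 by norm_num) (show (-0.1 : ℝ) < 0 by norm_num)).umin) *
        ((bandBounds (show (-4 : ℝ) < -1.1 by norm_num) (show (-1.1 : ℝ) ≤ -0.1 by norm_num) (show (-0.1 : ℝ) < 0 by norm_num)).umin * w / (4 + 2 * A))) / 2) :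
    ∃ ε : ℝ, (ε = 1 ∨ ε = -1) ∧ ∀ x ∈ Icc (0 - δ) (0 + δ),
      (2 / π * (((bandBounds (show (-4 : ℝ) < -1.1 by norm_num) (show (-1.1 : ℝ) ≤ -0.1 by norm_num) (show (-0.1 : ℝ) < 0 by norm_num)).Dtmin - 2 * A) *
        (bandBounds (show (-4 : ℝ) < -1.1 by norm_num) (show (-1.1 : ℝ) ≤ -0.1 by norm_num) (show (-0.1 : ℝ) < 0 by norm_num)).umin) *
        ((bandBounds (show (-4 : ℝ) < -1.1 by norm_num) (show (-1.1 : ℝ) ≤ -0.1 by norm_num) (show (-0.1 : ℝ) < 0 by norm_num)).umin * w / (4 + 2 * A))) / 2 *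
          |ϑ - π| ≤
        ε * deriv (fun φ : ℝ => frameLevel μ K (pairSumPath μ K 0 ϑ θ 0 - levelPoint μ K 0 (φ + θ))) x := by
  set B := bandBounds (show (-4 : ℝ) < -1.1 by norm_num) (show (-1.1 : ℝ) ≤ -0.1 by norm_num) (show (-0.1 : ℝ) < 0 by norm_num) with hBdef
  set G : ℝ := 2 / π * ((B.Dtmin - 2 * A) * B.umin) * (B.umin * w / (4 + 2 * A)) with hGdef
  have h0 : |(0 : ℝ)| < r := by simpa using hr
  have hADt : 2 * A < B.Dtmin := by have := klCurveD_pos; linarith only [this, hd]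
  have hA0 : 0 ≤ A := le_trans (norm_nonneg _) (hA 0 0 (by norm_num))
  have hDt : 0 < B.Dtmin - 2 * A := by linarith only [hADt]
  have hG0 : 0 ≤ G :=
    mul_nonneg (mul_nonneg (by positivity) (mul_nonneg hDt.le B.umin_pos.le))
      (by have := B.umin_pos; have := hG.wmin_pos; positivity)
  set g : ℝ → ℝ := deriv (fun φ : ℝ => frameLevel μ K (pairSumPath μ K 0 ϑ θ 0 - levelPoint μ K 0 (φ + θ))) with hgdef
  -- the slope at the crossing and its Gauss-map floor
  have hg0 : g 0 = -fderiv ℝ (frameLevel μ K) (levelPoint μ K 0 (ϑ + θ)) (iteratedDeriv 1 (levelPoint μ K 0) θ) :=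
    deriv_partnerBand_pp_angle_at_k hA hd hr hlo hhi 0 ϑ θ
  have hT := abs_transversality_pp_at_k_ge hA hd hr hlo hhi hG h0 ϑ θ
  rw [abs_zero, mul_zero, zero_div, sub_zero] at hT
  have hmin := abs_sub_pi_le_min_torusDist hϑ
  have hg0abs : G * |ϑ - π| ≤ |g 0| := by
    rw [hg0, abs_neg]
    refine le_trans ?_ hT
    have : 2 / π * ((B.Dtmin - 2 * A) * B.umin) * (B.umin * w / (4 + 2 * A) * min (torusDist ϑ) (torusDist (ϑ - π))) =
        G * min (torusDist ϑ) (torusDist (ϑ - π)) := by rw [hGdef]; ring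
    rw [this]; exact mul_le_mul_of_nonneg_left hmin hG0
  -- the drift of the slope on the neighbourhood
  have hS : ‖pairSumPath μ K 0 ϑ θ 0‖ ≤ msD A₃ A₄ 1 * |ϑ - π| := by
    have h := norm_pairSumPath_zero_le hA hA20 hd hr hlo hhi hA₃ hA₄ h0 ϑ θ
    rwa [abs_zero, zero_div, zero_add] at h
  have hdrift : ∀ x ∈ Icc (0 - δ) (0 + δ), |g x - g 0| ≤ G / 2 * |ϑ - π| := by
    intro x hx
    have hxδ : |x - 0| ≤ δ := by rw [sub_zero, abs_le]; constructor <;> linarith [hx.1, hx.2]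
    have h := abs_deriv_partnerBand_pp_angle_sub_le hA hA20 hd hlo hhi hA₃ hA₄ hK₂ hK₃ 0 h0 ϑ θ x 0
    have hM0 : 0 ≤ (K₃ * msD A₃ A₄ 1 ^ 2 + K₂ * msD A₃ A₄ 2) := by
      have := (norm_nonneg _).trans (hK₂ 0); have := (norm_nonneg _).trans (hK₃ 0)
      have := (msD_one_pos A₃ A₄).le
      have : 0 ≤ msD A₃ A₄ 2 := (norm_nonneg _).trans (norm_iteratedDeriv_levelPoint_le hA hA20 hd hlo hhi hA₃ hA₄ h0 (i := 2) (by norm_num) (by norm_num) 0)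
      positivity
    calc |g x - g 0| ≤ (K₃ * msD A₃ A₄ 1 ^ 2 + K₂ * msD A₃ A₄ 2) * ‖pairSumPath μ K 0 ϑ θ 0‖ * |x - 0| := h
      _ ≤ (K₃ * msD A₃ A₄ 1 ^ 2 + K₂ * msD A₃ A₄ 2) * (msD A₃ A₄ 1 * |ϑ - π|) * δ :=
          mul_le_mul (mul_le_mul_of_nonneg_left hS hM0) hxδ (abs_nonneg _) (mul_nonneg hM0 (mul_nonneg (msD_one_pos A₃ A₄).le (abs_nonneg _)))
      _ = ((K₃ * msD A₃ A₄ 1 ^ 2 + K₂ * msD A₃ A₄ 2) * msD A₃ A₄ 1 * δ) * |ϑ - π| := by ring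
      _ ≤ G / 2 * |ϑ - π| := mul_le_mul_of_nonneg_right hδrow (abs_nonneg _)
  -- the sign
  refine ⟨if 0 ≤ g 0 then 1 else -1, by split_ifs <;> simp, fun x hx => ?_⟩
  have hεg0 : (if 0 ≤ g 0 then (1 : ℝ) else -1) * g 0 = |g 0| := by
    split_ifs with h
    · rw [one_mul, abs_of_nonneg h]
    · rw [abs_of_neg (lt_of_not_ge h)]; ring
  have hεgx : (if 0 ≤ g 0 then (1 : ℝ) else -1) * g x ≥ |g 0| - |g x - g 0| := by
    rw [← hεg0]
    have habs := abs_le.1 (le_refl |g x - g 0|)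
    split_ifs with h
    · have := neg_abs_le (g x - g 0); linarith
    · have := le_abs_self (g x - g 0); linarith
  have := hdrift x hx
  show G / 2 * |ϑ - π| ≤ _
  linarith [hg0abs]

omit hK₁ in
/-- **SLOPE ROW AT THE CROSSING `q′` (`φ = ϑ`), NEAR COOPER, `ρ = e = 0`**: same statement on `|x − ϑ| ≤ δ`. [cite: BenfattoGiulianiMastropietro2003, §7.1 Lemma 7.1 (A1.9)] -/
theorem exists_sign_slope_row_at_q_cooper {Kc r₀ g₀ w : ℝ} (hG : GeomConstants (frameLevel μ K) Kc r₀ g₀ w) {ϑ : ℝ} (hϑ : |ϑ - π| ≤ π / 2) (θ : ℝ)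
    {δ : ℝ}
    (hδrow : (K₃ * msD A₃ A₄ 1 ^ 2 + K₂ * msD A₃ A₄ 2) * msD A₃ A₄ 1 * δ ≤
      (2 / π * (((bandBounds (show (-4 : ℝ) < -1.1 by norm_num) (show (-1.1 : ℝ) ≤ -0.1 by norm_num) (show (-0.1 : ℝ) < 0 by norm_num)).Dtmin - 2 * A) *
        (bandBounds (show (-4 : ℝ) < -1.1 by norm_num) (show (-1.1 : ℝ) ≤ -0.1 by norm_num) (show (-0.1 : ℝ) < 0 by norm_num)).umin) *
        ((bandBounds (show (-4 : ℝ) < -1.1 by norm_num) (show (-1.1 : ℝ) ≤ -0.1 by norm_num) (show (-0.1 : ℝ) < 0 by norm_num)).umin * w / (4 + 2 * A))) / 2) :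
    ∃ ε : ℝ, (ε = 1 ∨ ε = -1) ∧ ∀ x ∈ Icc (ϑ - δ) (ϑ + δ),
      (2 / π * (((bandBounds (show (-4 : ℝ) < -1.1 by norm_num) (show (-1.1 : ℝ) ≤ -0.1 by norm_num) (show (-0.1 : ℝ) < 0 by norm_num)).Dtmin - 2 * A) *
        (bandBounds (show (-4 : ℝ) < -1.1 by norm_num) (show (-1.1 : ℝ) ≤ -0.1 by norm_num) (show (-0.1 : ℝ) < 0 by norm_num)).umin) *
        ((bandBounds (show (-4 : ℝ) < -1.1 by norm_num) (show (-1.1 : ℝ) ≤ -0.1 by norm_num) (show (-0.1 : ℝ) < 0 by norm_num)).umin * w / (4 + 2 * A))) / 2 *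
          |ϑ - π| ≤
        ε * deriv (fun φ : ℝ => frameLevel μ K (pairSumPath μ K 0 ϑ θ 0 - levelPoint μ K 0 (φ + θ))) x := by
  set B := bandBounds (show (-4 : ℝ) < -1.1 by norm_num) (show (-1.1 : ℝ) ≤ -0.1 by norm_num) (show (-0.1 : ℝ) < 0 by norm_num) with hBdef
  set G : ℝ := 2 / π * ((B.Dtmin - 2 * A) * B.umin) * (B.umin * w / (4 + 2 * A)) with hGdef
  have h0 : |(0 : ℝ)| < r := by simpa using hr
  have h0' : |(0 : ℝ)| < r₀ := by simpa using hG.r₀_pos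
  have hADt : 2 * A < B.Dtmin := by have := klCurveD_pos; linarith only [this, hd]
  have hA0 : 0 ≤ A := le_trans (norm_nonneg _) (hA 0 0 (by norm_num))
  have hDt : 0 < B.Dtmin - 2 * A := by linarith only [hADt]
  have hG0 : 0 ≤ G :=
    mul_nonneg (mul_nonneg (by positivity) (mul_nonneg hDt.le B.umin_pos.le))
      (by have := B.umin_pos; have := hG.wmin_pos; positivity)
  set g : ℝ → ℝ := deriv (fun φ : ℝ => frameLevel μ K (pairSumPath μ K 0 ϑ θ 0 - levelPoint μ K 0 (φ + θ))) with hgdef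
  have hgϑ : g ϑ = -fderiv ℝ (frameLevel μ K) (levelPoint μ K 0 θ) (iteratedDeriv 1 (levelPoint μ K 0) (ϑ + θ)) :=
    deriv_partnerBand_pp_angle_at_q hA hd hlo hhi h0 ϑ θ
  have hT := abs_transversality_pp_at_q_ge hA hd hr hlo hhi hG h0 h0' ϑ θ
  rw [abs_zero, mul_zero, zero_div, sub_zero] at hT
  have hmin := abs_sub_pi_le_min_torusDist hϑ
  have hgϑabs : G * |ϑ - π| ≤ |g ϑ| := by
    rw [hgϑ, abs_neg]
    refine le_trans ?_ hT
    have : 2 / π * ((B.Dtmin - 2 * A) * B.umin) * (B.umin * w / (4 + 2 * A) * min (torusDist ϑ) (torusDist (ϑ - π))) =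
        G * min (torusDist ϑ) (torusDist (ϑ - π)) := by rw [hGdef]; ring
    rw [this]; exact mul_le_mul_of_nonneg_left hmin hG0
  have hS : ‖pairSumPath μ K 0 ϑ θ 0‖ ≤ msD A₃ A₄ 1 * |ϑ - π| := by
    have h := norm_pairSumPath_zero_le hA hA20 hd hr hlo hhi hA₃ hA₄ h0 ϑ θ
    rwa [abs_zero, zero_div, zero_add] at h
  have hdrift : ∀ x ∈ Icc (ϑ - δ) (ϑ + δ), |g x - g ϑ| ≤ G / 2 * |ϑ - π| := by
    intro x hx
    have hxδ : |x - ϑ| ≤ δ := by rw [abs_le]; constructor <;> linarith [hx.1, hx.2]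
    have h := abs_deriv_partnerBand_pp_angle_sub_le hA hA20 hd hlo hhi hA₃ hA₄ hK₂ hK₃ 0 h0 ϑ θ x ϑ
    have hM0 : 0 ≤ (K₃ * msD A₃ A₄ 1 ^ 2 + K₂ * msD A₃ A₄ 2) := by
      have := (norm_nonneg _).trans (hK₂ 0); have := (norm_nonneg _).trans (hK₃ 0)
      have := (msD_one_pos A₃ A₄).le
      have : 0 ≤ msD A₃ A₄ 2 := (norm_nonneg _).trans (norm_iteratedDeriv_levelPoint_le hA hA20 hd hlo hhi hA₃ hA₄ h0 (i := 2) (by norm_num) (by norm_num) 0)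
      positivity
    calc |g x - g ϑ| ≤ (K₃ * msD A₃ A₄ 1 ^ 2 + K₂ * msD A₃ A₄ 2) * ‖pairSumPath μ K 0 ϑ θ 0‖ * |x - ϑ| := h
      _ ≤ (K₃ * msD A₃ A₄ 1 ^ 2 + K₂ * msD A₃ A₄ 2) * (msD A₃ A₄ 1 * |ϑ - π|) * δ :=
          mul_le_mul (mul_le_mul_of_nonneg_left hS hM0) hxδ (abs_nonneg _) (mul_nonneg hM0 (mul_nonneg (msD_one_pos A₃ A₄).le (abs_nonneg _)))
      _ = ((K₃ * msD A₃ A₄ 1 ^ 2 + K₂ * msD A₃ A₄ 2) * msD A₃ A₄ 1 * δ) * |ϑ - π| := by ring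
      _ ≤ G / 2 * |ϑ - π| := mul_le_mul_of_nonneg_right hδrow (abs_nonneg _)
  refine ⟨if 0 ≤ g ϑ then 1 else -1, by split_ifs <;> simp, fun x hx => ?_⟩
  have hεg0 : (if 0 ≤ g ϑ then (1 : ℝ) else -1) * g ϑ = |g ϑ| := by
    split_ifs with h
    · rw [one_mul, abs_of_nonneg h]
    · rw [abs_of_neg (lt_of_not_ge h)]; ring
  have hεgx : (if 0 ≤ g ϑ then (1 : ℝ) else -1) * g x ≥ |g ϑ| - |g x - g ϑ| := by
    rw [← hεg0]
    split_ifs with h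
    · have := neg_abs_le (g x - g ϑ); linarith
    · have := le_abs_self (g x - g ϑ); linarith
  have := hdrift x hx
  show G / 2 * |ϑ - π| ≤ _
  linarith [hgϑabs]

omit hK₃ in
/-- **THE `H₀` ROW** (`ρ = 0`, any loop level `|e| < r`): `|∂_ψ|_θ e_K(Φ(0,ψ) + Φ(0,ϑ+ψ) − Φ(e,t+ψ))| ≤ (K₁msD₂ + K₂msD₁²)·|ϑ − π|`
(`…C4aPartnerBandCooperDefect.abs_deriv_partnerBand_pp_le` through the base-angle bridge). -/
theorem abs_baseDeriv_partnerBand_pp_le_cooper_zero {e : ℝ} (he : |e| < r) (ϑ θ t : ℝ) :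
    |deriv (fun ψ : ℝ => frameLevel μ K (levelPoint μ K 0 ψ + levelPoint μ K 0 (ϑ + ψ) - levelPoint μ K e (t + ψ))) θ| ≤
      (K₁ * msD A₃ A₄ 2 + K₂ * msD A₃ A₄ 1 * msD A₃ A₄ 1) * |ϑ - π| := by
  have h0 : |(0 : ℝ)| < r := by simpa using hr
  rw [← iteratedDeriv_one, iteratedDeriv_partnerBand_pp_base_eq μ K 0 ϑ e t θ 1, iteratedDeriv_one]
  have h := abs_deriv_partnerBand_pp_le hA hA20 hd hr hlo hhi hA₃ hA₄ hK₁ hK₂ h0 he ϑ θ (t + θ)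
  rw [abs_zero, mul_zero, zero_add, zero_div, zero_add] at h
  calc _ ≤ K₁ * (msD A₃ A₄ 2 * |ϑ - π|) + K₂ * (msD A₃ A₄ 1 * |ϑ - π|) * msD A₃ A₄ 1 := h
    _ = (K₁ * msD A₃ A₄ 2 + K₂ * msD A₃ A₄ 1 * msD A₃ A₄ 1) * |ϑ - π| := by ring

omit hK₁ in
/-- **THE `H₁` ROW** (`ρ = 0`, any loop level `|e| < r`): `|∂_φ ∂_ψ|_θ e_K(Φ(0,ψ) + Φ(0,ϑ+ψ) − Φ(e,φ+ψ))| ≤ (K₂msD₁msD₂ + (K₃msD₁² + K₂msD₂)msD₁)·|ϑ − π|`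
(`…C4aCooperDefectMixedPP.abs_deriv_anisotropy_pp_le_cooper` with `S = Φ(0,θ)+Φ(0,ϑ+θ)`, `S′ = ∂S`, and the rigidity sizes `‖S‖ ≤ msD₁|ϑ−π|`, `‖S′‖ ≤ msD₂|ϑ−π|`). -/
theorem abs_deriv_baseDeriv_partnerBand_pp_le_cooper_zero {e : ℝ} (he : |e| < r) (ϑ θ x : ℝ) :
    |deriv (fun φ : ℝ => deriv (fun ψ : ℝ => frameLevel μ K (levelPoint μ K 0 ψ + levelPoint μ K 0 (ϑ + ψ) - levelPoint μ K e (φ + ψ))) θ) x| ≤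
      (K₂ * msD A₃ A₄ 1 * msD A₃ A₄ 2 + (K₃ * msD A₃ A₄ 1 ^ 2 + K₂ * msD A₃ A₄ 2) * msD A₃ A₄ 1) * |ϑ - π| := by
  have h0 : |(0 : ℝ)| < r := by simpa using hr
  set S : Momentum := levelPoint μ K 0 θ + levelPoint μ K 0 (ϑ + θ) with hSdef
  set Sp : Momentum := iteratedDeriv 1 (levelPoint μ K 0) θ + iteratedDeriv 1 (levelPoint μ K 0) (ϑ + θ) with hSpdef
  have hfun : (fun φ : ℝ => deriv (fun ψ : ℝ => frameLevel μ K (levelPoint μ K 0 ψ + levelPoint μ K 0 (ϑ + ψ) - levelPoint μ K e (φ + ψ))) θ) =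
      fun φ : ℝ => (fderiv ℝ (frameLevel μ K) (S - levelPoint μ K e (φ + θ))) (Sp - deriv (fun y : ℝ => levelPoint μ K e (y + θ)) φ) := by
    funext φ
    rw [(hasDerivAt_partnerBand_pp_base hA hd hr hlo hhi h0 he ϑ φ θ).deriv, deriv_comp_add_const_eq_iteratedDeriv]
  rw [hfun]
  have h := abs_deriv_anisotropy_pp_le_cooper hA hA20 hd hlo hhi hA₃ hA₄ hK₂ hK₃ he θ S Sp x
  have hS : ‖S‖ ≤ msD A₃ A₄ 1 * |ϑ - π| := by
    have h1 := norm_pairSumPath_zero_le hA hA20 hd hr hlo hhi hA₃ hA₄ h0 ϑ θ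
    rw [abs_zero, zero_div, zero_add] at h1
    have : pairSumPath μ K 0 ϑ θ 0 = S := by simp only [hSdef, pairSumPath, add_zero]
    rwa [this] at h1
  have hSp : ‖Sp‖ ≤ msD A₃ A₄ 2 * |ϑ - π| := by
    have h1 := norm_deriv_pairSumPath_le_rigid hA hA20 hd hr hlo hhi hA₃ hA₄ h0 ϑ θ
    rw [abs_zero, mul_zero, zero_add, iteratedDeriv_pairSumPath_zero hA hd hr hlo hhi h0 ϑ θ 1] at h1
    exact h1
  have hK₂0 : 0 ≤ K₂ := (norm_nonneg _).trans (hK₂ 0)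
  have hK₃0 : 0 ≤ K₃ := (norm_nonneg _).trans (hK₃ 0)
  have hD1 : 0 ≤ msD A₃ A₄ 1 := (msD_one_pos A₃ A₄).le
  have hD2 : 0 ≤ msD A₃ A₄ 2 := (norm_nonneg _).trans (norm_iteratedDeriv_levelPoint_le hA hA20 hd hlo hhi hA₃ hA₄ h0 (i := 2) (by norm_num) (by norm_num) 0)
  calc _ ≤ K₂ * msD A₃ A₄ 1 * ‖Sp‖ + (K₃ * msD A₃ A₄ 1 ^ 2 + K₂ * msD A₃ A₄ 2) * ‖S‖ := h
    _ ≤ K₂ * msD A₃ A₄ 1 * (msD A₃ A₄ 2 * |ϑ - π|) + (K₃ * msD A₃ A₄ 1 ^ 2 + K₂ * msD A₃ A₄ 2) * (msD A₃ A₄ 1 * |ϑ - π|) := by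
        gcongr
    _ = (K₂ * msD A₃ A₄ 1 * msD A₃ A₄ 2 + (K₃ * msD A₃ A₄ 1 ^ 2 + K₂ * msD A₃ A₄ 2) * msD A₃ A₄ 1) * |ϑ - π| := by ring

end Sizes

end Summit.HubbardSuperconductivity.HubbardSuperconductivity.Theorems.C4a

end
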